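import Literature.AlgebraicGeometry.Frobenioids.ModelFrobenioidRatFunTransport
import Literature.AlgebraicGeometry.Frobenioids.PadicFieldwiseSaturatedTransportTemperedBase
import Literature.AlgebraicGeometry.Frobenioids.PadicKummerThm24iFrobenioidRelOfEquivalence
import Literature.AlgebraicGeometry.Frobenioids.Cor411AsPrinted
import Literature.AlgebraicGeometry.Frobenioids.PadicFrobenioidCZeroGalois
import Literature.AlgebraicGeometry.Frobenioids.PadicFrobenioidRational
import HarnessLib

/-!
# Frobenioids II, Theorem 2.4 (i), first clause «`Φ₁` is fieldwise saturated if and only if `Φ₂` is» — from an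
# EQUIVALENCE `Ψ : C₁ ⥲ C₂` ALONE over the printed §2 bases `Dᵢ = B^temp(Πᵢ, Πᵢ°)⁰` (the hypothesis `hfs` DISCHARGED)

Mochizuki, *The geometry of Frobenioids II*, Kyushu J. Math. **62** (2008) 401–460, §2, Thm. 2.4 (i) p. 19 and its
proof p. 20 ll. 12–42 [cite: MochizukiFrdII2008, Thm 2.4 (i) p.20]: "Φ₁ is fieldwise saturated if and only if Φ₂ is. …
Proof. … Moreover, since `Cᵢ` is a Frobenioid of rationally standard type [cf. Theorem 1.2, (i); Example 1.3, (i)] over a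
slim base category [cf. Example 1.3, (i)], it follows from [Mzk5], Corollaries 4.10; 4.11, (ii), (iii), that `Ψ` induces a
1-compatible equivalence of categories `Ψ^Base : D₁ ⥲ D₂`, as well as compatible isomorphisms of functors `Φ₁ ⥲ Φ₂`,
`B₁ ⥲ B₂` … hence that these conditions (a), (b) are preserved by `Ψ`. Thus, `Φ₁` is fieldwise saturated if and only
if `Φ₂` is."

PROOF-ONLY file (cell abc-iut, layer L1, seat abc-iut-L1-t10 gen 9; row «HFS-FROM-Ψ» = SUBDAG-FrdII-Thm24 rows L02/L03 at
the p-adic data; L1-lead GO 2026-08-26T13:10Z / GO-2 13:23Z).  abc-iut-w5-d229's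
`PadicFrd.Datum.isFieldwiseSaturated_iff_of_equiv_temperedBase` proved the displayed sentence from the [FrdI] Cor. 4.10 /
4.11 comparison data `(E, φ, β)` as BINDERS; here those binders are THEOREMS for an equivalence `Ψ` of the `pᵢ`-adic
Frobenioids over `RelCosetCat Πᵢ°` (`Πᵢ` temp-slim tempered, `Πᵢ → G_{ℚ_{pᵢ}}` open homomorphisms — print's standing
hypotheses p. 19), every input consumed BY NAME: [FrdI] Thm. 3.4 (ii)/(v) (abc-iut-L1-t13/t11 `FrdI.thm34ii_ofFunctor`,
abc-iut-L1-t7 `PadicFrd.exists_baseEquivalence`), [FrdI] Cor. 4.11 / Thm. 4.9 (abc-iut-L1-d6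
`FrdI.exists_divisorMonoidIsoOver_div_ofFunctor`, `FrdI.preservesDegFr_of_cor411Setting`) at the `Cor411Setting` supplied by
[FrdII] Thm. 1.2 (i) (abc-iut-L1-t4/d8/d10 `Datum.rel_isFrobenioid`, `rel_isOfStandardType`, `isPerfFactorialOn`,
`isRational`) and the slimness of `B^temp(Π, Π°)⁰` (`Datum.rel_isSlim_base`, [FrdI] Rmk. 4.11.1 `isDivSlim_of_isSlim`), and
[FrdI] Cor. 4.10 + Thm. 5.2 (ii) on the rational function monoid (this seat's
`ModelFrobenioid.exists_comparisonData_of_equivalence`, `ModelFrobenioidRatFunTransport.lean`):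
* `PadicFrd.baseEquivalent_map_of_baseIso` — `Ψ` preserves base-equivalent pairs (from any `η : Ψ ⋙ Base₂ ≅ Base₁ ⋙ E`);
* `PadicFrd.isPullbackMorphism_map_of_divisorMonoidIsoOver` — `Ψ` preserves pull-back morphisms of the model Frobenioids
  (Thm. 5.2 (ii): these are the linear morphisms with `Div = 0`; degrees by Cor. 4.11, divisors by `Ψ^Φ`);
* **`PadicFrd.Datum.isFieldwiseSaturated_iff_of_equivalence_temperedBase : d₁.IsFieldwiseSaturated ↔ d₂.IsFieldwiseSaturated`**
  for every equivalence `Ψ : d₁.frobenioid ≌ d₂.frobenioid` — the hypothesis `hfs` of abc-iut-L1-t7's Thm. 2.4 (i) assembly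
  `thm24i_ofEquivalenceRel`, now a theorem.
No definitions, no new `Prop`; nothing here bears on [IUTchIII] Cor. 3.12; no statement of the paper is strengthened.
-/

noncomputable section

namespace Literature.AlgebraicGeometry.Frobenioids

namespace PadicFrd

open CategoryTheory Opposite Function Literature.AnabelianGeometry.SemiGraphs QuasiTemperoid

/-! ### §1 Two transport facts for an equivalence of model Frobenioids -/

section Transport

universe w v u

variable {D₁ : Type u} [Category.{v} D₁] {Φ₁ B₁ : D₁ᵒᵖ ⥤ CommMonCat.{w}} {DivB₁ : B₁ ⟶ monoidGp Φ₁}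
  {D₂ : Type u} [Category.{v} D₂] {Φ₂ B₂ : D₂ᵒᵖ ⥤ CommMonCat.{w}} {DivB₂ : B₂ ⟶ monoidGp Φ₂}
  (Ψ : ModelFrobenioid Φ₁ B₁ DivB₁ ≌ ModelFrobenioid Φ₂ B₂ DivB₂)

/-- `Ψ` preserves base-equivalent pairs as soon as `Ψ ⋙ Base₂ ≅ Base₁ ⋙ E` for SOME functor `E` ("`Ψ` induces
`Ψ^Base`", [FrdI] Thm. 3.4 (v)). [cite: MochizukiFrdI2008, Thm. 3.4 (v) p.63] -/
theorem baseEquivalent_map_of_baseIso (E : D₁ ⥤ D₂)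
    (η : Ψ.functor ⋙ ModelFrobenioid.baseFunctor Φ₂ B₂ DivB₂ ≅ ModelFrobenioid.baseFunctor Φ₁ B₁ DivB₁ ⋙ E)
    ⦃A A' : ModelFrobenioid Φ₁ B₁ DivB₁⦄ (f g : A ⟶ A')
    (h : PreFrobenioid.BaseEquivalent (ModelFrobenioid.toElem Φ₁ B₁ DivB₁) f g) :
    PreFrobenioid.BaseEquivalent (ModelFrobenioid.toElem Φ₂ B₂ DivB₂) (Ψ.functor.map f) (Ψ.functor.map g) := by
  change ModelFrobenioid.baseMap f = ModelFrobenioid.baseMap g at h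
  change ModelFrobenioid.baseMap (Ψ.functor.map f) = ModelFrobenioid.baseMap (Ψ.functor.map g)
  have hf := η.hom.naturality f
  have hg := η.hom.naturality g
  change ModelFrobenioid.baseMap (Ψ.functor.map f) ≫ η.hom.app A' = η.hom.app A ≫ E.map (ModelFrobenioid.baseMap f) at hf
  change ModelFrobenioid.baseMap (Ψ.functor.map g) ≫ η.hom.app A' = η.hom.app A ≫ E.map (ModelFrobenioid.baseMap g) at hg
  rw [h] at hf
  exact (cancel_mono (η.hom.app A')).mp (hf.trans hg.symm)

/-- `Ψ` preserves pull-back morphisms of the model Frobenioids (`Bᵢ` group-like, `Φᵢ` divisorial: by [FrdI] Thm. 5.2 (ii)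
these are the linear morphisms with `Div = 0`, `ModelFrobenioid.isPullbackMorphism_iff`) as soon as it preserves Frobenius
degrees and carries a `Ψ^Φ` with the divisor clause ([FrdI] Thm. 3.4 (iii) / Cor. 4.11 (iii)).
[cite: MochizukiFrdI2008, Cor. 4.11 (iii) p.92] -/
theorem isPullbackMorphism_map_of_divisorMonoidIsoOver
    (hBg₁ : Objectwise (fun M _ => IsGroupLike M) B₁) (hΦd₁ : Objectwise (fun M _ => IsDivisorial M) Φ₁)
    (hBg₂ : Objectwise (fun M _ => IsGroupLike M) B₂) (hΦd₂ : Objectwise (fun M _ => IsDivisorial M) Φ₂)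
    (hdeg : PreFrobenioidData.PreservesDegFr (ModelFrobenioid.data Φ₁ B₁ DivB₁) (ModelFrobenioid.data Φ₂ B₂ DivB₂) Ψ)
    (ΨΦ : (ModelFrobenioid.data Φ₁ B₁ DivB₁).DivisorMonoidIsoOver (ModelFrobenioid.data Φ₂ B₂ DivB₂) Ψ)
    (hdiv : ∀ ⦃A A' : ModelFrobenioid Φ₁ B₁ DivB₁⦄ (φ : A ⟶ A'),
      ΨΦ.iso A (PreFrobenioid.Div (ModelFrobenioid.toElem Φ₁ B₁ DivB₁) φ) =
        PreFrobenioid.Div (ModelFrobenioid.toElem Φ₂ B₂ DivB₂) (Ψ.functor.map φ))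
    ⦃A A' : ModelFrobenioid Φ₁ B₁ DivB₁⦄ (ψ : A ⟶ A')
    (hψ : PreFrobenioid.IsPullbackMorphism (ModelFrobenioid.toElem Φ₁ B₁ DivB₁) ψ) :
    PreFrobenioid.IsPullbackMorphism (ModelFrobenioid.toElem Φ₂ B₂ DivB₂) (Ψ.functor.map ψ) := by
  obtain ⟨h₁, h₂⟩ := (ModelFrobenioid.isPullbackMorphism_iff hΦd₁ hBg₁ ψ).mp hψ
  refine ModelFrobenioid.isPullbackMorphism_of hΦd₂ hBg₂ ?_ ?_
  · have h := hdeg ψ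
    change ModelFrobenioid.degFr (Ψ.functor.map ψ) = ModelFrobenioid.degFr ψ at h
    rw [h, h₁]
  · have h := hdiv ψ
    change ΨΦ.iso A (ModelFrobenioid.div ψ) = ModelFrobenioid.div (Ψ.functor.map ψ) at h
    rw [← h, h₂]
    exact map_one (ΨΦ.iso A)

end Transport

/-! ### §2 «`Φ₁` is fieldwise saturated if and only if `Φ₂` is» from `Ψ` alone -/

namespace Datum

variable {p₁ p₂ : ℕ} [Fact p₁.Prime] [Fact p₂.Prime]
  {P₁ : Type} [Group P₁] [TopologicalSpace P₁] [IsTopologicalGroup P₁] (hP₁ : IsTempered P₁) (hZ₁ : IsSlimGroup P₁)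
  {φ₁ : P₁ →* GalFbar ℚ_[p₁]} (hφ₁ : IsOpenHom φ₁) {P₁₀ : OpenSubgroup P₁}
  {d₁ : Datum (RelCosetCat P₁₀) p₁} (hd₁ : d₁.base = relBaseGal p₁ P₁₀ φ₁ hφ₁)
  {P₂ : Type} [Group P₂] [TopologicalSpace P₂] [IsTopologicalGroup P₂] (hP₂ : IsTempered P₂) (hZ₂ : IsSlimGroup P₂)
  {φ₂ : P₂ →* GalFbar ℚ_[p₂]} (hφ₂ : IsOpenHom φ₂) {P₂₀ : OpenSubgroup P₂}
  {d₂ : Datum (RelCosetCat P₂₀) p₂} (hd₂ : d₂.base = relBaseGal p₂ P₂₀ φ₂ hφ₂)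
  (Ψ : d₁.frobenioid ≌ d₂.frobenioid)

include hP₁ hZ₁ hd₁ hP₂ hZ₂ hd₂ Ψ in
/-- **[FrdII] Theorem 2.4 (i), first clause, for the `p`-adic Frobenioids over the printed §2 bases
`Dᵢ = B^temp(Πᵢ, Πᵢ°)⁰` (`Πᵢ` temp-slim tempered, `Πᵢ → G_{ℚ_{pᵢ}}` open homomorphisms): an EQUIVALENCE `Ψ : C₁ ⥲ C₂`
alone gives «`Φ₁` is fieldwise saturated if and only if `Φ₂` is».**  Print's proof verbatim: Cor. 4.10 / 4.11 (ii)(iii)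
supply `Ψ^Base` (an equivalence, 1-compatibly) and compatible `Φ₁ ⥲ Φ₂`, `B₁ ⥲ B₂` preserving `O^⊳(−)`; (a), (b) are then
preserved (abc-iut-w5-d229's transport). [cite: MochizukiFrdII2008, Thm 2.4 (i) p.20] -/
theorem isFieldwiseSaturated_iff_of_equivalence_temperedBase : d₁.IsFieldwiseSaturated ↔ d₂.IsFieldwiseSaturated := by
  -- [FrdII] Thm. 1.2 (i) at the data: Frobenioids of standard type, `Φ` divisorial + perf-factorial, `B` group-like
  have hF₁ := d₁.rel_isFrobenioid
  have hF₂ := d₂.rel_isFrobenioid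
  have hs₁ := d₁.rel_isOfStandardType
  have hs₂ := d₂.rel_isOfStandardType
  have hΦd₁ : Objectwise (fun M _ => IsDivisorial M) d₁.Φ := fun A => (d₁.isMonoprime (op A)).isDivisorial
  have hΦd₂ : Objectwise (fun M _ => IsDivisorial M) d₂.Φ := fun A => (d₂.isMonoprime (op A)).isDivisorial
  have hBg₁ : Objectwise (fun M _ => IsGroupLike M) d₁.B := fun A => isGroupLike_of_forall_isUnit (d₁.isUnit_B (op A))
  have hBg₂ : Objectwise (fun M _ => IsGroupLike M) d₂.B := fun A => isGroupLike_of_forall_isUnit (d₂.isUnit_B (op A))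
  -- the base `B^temp(Π, Π°)⁰` is slim (`Π` temp-slim tempered), hence Div-slim: the `Cor411Setting`
  have hset : (ModelFrobenioid.data d₁.Φ d₁.B d₁.divB).Cor411Setting (ModelFrobenioid.data d₂.Φ d₂.B d₂.divB) Ψ :=
    ⟨⟨PreFrobenioidData.isDivSlim_of_isSlim _ (Datum.rel_isSlim_base (P₀ := P₁₀) hP₁ hZ₁),
      PreFrobenioidData.isDivSlim_of_isSlim _ (Datum.rel_isSlim_base (P₀ := P₂₀) hP₂ hZ₂)⟩, ⟨hs₁, hs₂⟩, hypB_rel Ψ⟩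
  -- [FrdI] Thm. 3.4 (ii) for `Ψ`, `Ψ⁻¹`: co-angular pre-steps
  obtain ⟨-, hca, -⟩ := FrdI.thm34ii_ofFunctor hF₁ hF₂ Ψ hs₁.quasiIsotropic hs₂.quasiIsotropic hs₁.fsmff hs₂.fsmff
  obtain ⟨-, hca', -⟩ := FrdI.thm34ii_ofFunctor hF₂ hF₁ Ψ.symm hs₂.quasiIsotropic hs₁.quasiIsotropic hs₂.fsmff hs₁.fsmff
  have hΨ : ∀ ⦃A A' : d₁.frobenioid⦄ (f : A ⟶ A'), PreFrobenioid.IsCoAngularPreStep d₁.structureFunctor f →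
      PreFrobenioid.IsCoAngularPreStep d₂.structureFunctor (Ψ.functor.map f) := fun A A' f hf =>
    (PreFrobenioidData.ofFunctor_isCoAngularPreStep _ _).mp (hca f ((PreFrobenioidData.ofFunctor_isCoAngularPreStep _ _).mpr hf))
  have hΨ' : ∀ ⦃A A' : d₂.frobenioid⦄ (f : A ⟶ A'), PreFrobenioid.IsCoAngularPreStep d₂.structureFunctor f →
      PreFrobenioid.IsCoAngularPreStep d₁.structureFunctor (Ψ.inverse.map f) := fun A A' f hf =>
    (PreFrobenioidData.ofFunctor_isCoAngularPreStep _ _).mp (hca' f ((PreFrobenioidData.ofFunctor_isCoAngularPreStep _ _).mpr hf))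
  -- [FrdI] Thm. 3.4 (v) for `Ψ`, `Ψ⁻¹`: `Ψ^Base` an equivalence with `η`; base-equivalent pairs
  obtain ⟨E, ⟨η⟩⟩ := exists_baseEquivalence hP₁ hZ₁ hP₂ hZ₂ Ψ
  obtain ⟨E', ⟨η'⟩⟩ := exists_baseEquivalence hP₂ hZ₂ hP₁ hZ₁ Ψ.symm
  have hb := baseEquivalent_map_of_baseIso Ψ E.functor η
  have hb' := baseEquivalent_map_of_baseIso Ψ.symm E'.functor η'
  -- [FrdI] Cor. 4.11 / Thm. 4.9: degrees and `Ψ^Φ` with the divisor clause; pull-back morphisms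
  have hdeg := FrdI.preservesDegFr_of_cor411Setting hF₁ hF₂ Ψ hset
  obtain ⟨ΨΦ, hdiv⟩ := FrdI.exists_divisorMonoidIsoOver_div_ofFunctor hF₁ hF₂ d₁.isPerfFactorialOn d₂.isPerfFactorialOn
    (fun A => d₁.isRational hF₁ (PreFrobenioid.hasBiratSquares_of_isFrobenioid hF₁) (fun a 𝔭 => PrimarySupp a 𝔭)
      (fun _ _ _ => Iff.rfl) A) Ψ hset
  have hpb := isPullbackMorphism_map_of_divisorMonoidIsoOver Ψ hBg₁ hΦd₁ hBg₂ hΦd₂ hdeg ΨΦ hdiv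
  -- [FrdI] Cor. 4.10 + Thm. 5.2 (ii): the comparison data over `G = zeroSection ⋙ Ψ ⋙ Base`
  obtain ⟨φ, β, hφ, hβ, hβdiv⟩ := ModelFrobenioid.exists_comparisonData_of_equivalence hBg₁ hΦd₁ hBg₂ hΦd₂ hF₁ hF₂ Ψ
    hΨ hb hΨ' hb' hpb ΨΦ hdiv
  -- `G ≅ Ψ^Base` via `η`, so `G` is an equivalence
  haveI : (ModelFrobenioid.zeroSection d₁.Φ d₁.B d₁.divB ⋙ Ψ.functor ⋙
      ModelFrobenioid.baseFunctor d₂.Φ d₂.B d₂.divB).IsEquivalence :=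
    Functor.isEquivalence_of_iso
      (E.functor.leftUnitor.symm ≪≫
        eqToIso (congrArg (fun F => F ⋙ E.functor)
          (ModelFrobenioid.zeroSection_comp_baseFunctor (Φ := d₁.Φ) (B := d₁.B) (DivB := d₁.divB)).symm) ≪≫
        Functor.associator _ _ _ ≪≫ Functor.isoWhiskerLeft (ModelFrobenioid.zeroSection d₁.Φ d₁.B d₁.divB) η.symm)
  -- abc-iut-w5-d229's transport of (a), (b)
  exact isFieldwiseSaturated_iff_of_equiv_temperedBase hφ₁.continuous hP₁ hφ₂.continuous hP₂
    (P₁ := CosetCat.admitsHomTo P₁₀) (fun f h => CosetCat.admitsHomTo_of_hom P₁₀ f h)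
    (P₂ := CosetCat.admitsHomTo P₂₀) (fun f h => CosetCat.admitsHomTo_of_hom P₂₀ f h) d₁ d₂
    (hd₁.trans (relBaseGal_eq p₁ P₁₀ φ₁ hφ₁)) (hd₂.trans (relBaseGal_eq p₂ P₂₀ φ₂ hφ₂))
    (ModelFrobenioid.zeroSection d₁.Φ d₁.B d₁.divB ⋙ Ψ.functor ⋙ ModelFrobenioid.baseFunctor d₂.Φ d₂.B d₂.divB).asEquivalence
    φ hφ β hβ hβdiv

end Datum

end PadicFrd

end Literature.AlgebraicGeometry.Frobenioids

end
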